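import Literature.NumberTheory.Automorphic.CuspidalCohomologyGLShapiroSum
import Literature.NumberTheory.Automorphic.CompletedCohomology
import HarnessLib

/-!
# Restricting the adelic variable of `H^q(Γ, Fun(𝒢 ⧸ L, V))` to a subgroup `H ≤ 𝒢` through which `Γ` maps

Topic `NumberTheory/Automorphic`; namespace `Literature.NumberTheory.Automorphic`, grouping
sub-namespace `TwistedQuotient` (as `CuspidalCohomologyGL`).

Let `ι : Γ → 𝒢`, `L ≤ 𝒢`, `ρ : Γ → GL(V)` be the data of the twisted cohomology
`H^q(S_L, Ṽ) = H^q(Γ, Fun(𝒢 ⧸ L, V))` (`TwistedQuotient.cohomology ι L ρ q`) and let `H ≤ 𝒢` be a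
subgroup CONTAINING `ι(Γ)`.  The `H`-orbit of the base point of `𝒢 ⧸ L` is `H ⧸ (H ∩ L)`
(`toQuot : H ⧸ L.subgroupOf H ↪ 𝒢 ⧸ L`, injective and `H`-equivariant), so restriction of functions
is a morphism of `Γ`-representations
`subgroupRestrict : Fun(𝒢 ⧸ L, V) ⟶ Fun(H ⧸ (H ∩ L), V)` (for `ι` co-restricted to `H`), inducing
`subgroupRestrictMap : H^q(Γ, Fun(𝒢 ⧸ L, V)) ⟶ H^q(Γ, Fun(H ⧸ (H ∩ L), V))`.

* **When `H L = 𝒢`** (e.g. `H ⊇` a parabolic `P(𝔸_f^S) × 𝒢_S` and `L ⊇ K^S` hyperspecial away from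
  `S`, by the Iwasawa decomposition) `toQuot` is a bijection and `subgroupRestrict` an ISOMORPHISM
  of representations (`subgroupRestrict_bijective`, `isIso_subgroupRestrictMap`): the cohomology of
  `S_L` is computed in the smaller ambient group `H`, **`H^q(Γ, Fun(𝒢 ⧸ L, V)) ≅ H^q(Γ, Fun(H ⧸ (H ∩ L), V))`**.
* **Hecke operators.**  If the double coset `L g L / L` is the image under `toQuot` of a disjoint
  union of finitely many `H`-double cosets `(H ∩ L) h_j (H ∩ L) / (H ∩ L)`, then restriction
  intertwines `T_g = [L g L]` with `∑_j [(H∩L) h_j (H∩L)]` (`subgroupRestrictLinear_heckeFun`, and on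
  cohomology `subgroupRestrictMap_heckeEnd_apply`).  For `GL₂` and a place `w` with `L_w = GL₂(𝒪_w)`,
  `H_w = B(F_w)`: `GL₂(𝒪) diag(ϖ,1) GL₂(𝒪) = ⊔_{β mod ϖ} n(β) diag(ϖ,1) GL₂(𝒪) ⊔ diag(1,ϖ) GL₂(𝒪)`, so
  `T_{w,1}` corresponds to `T^B_{diag(ϖ,1)} + T^B_{diag(1,ϖ)}` — the first step of the computation
  of the Hecke eigenvalues on the cohomology of the Borel stratum [Harder1987, §2].

The additivity of `groupCohomology.map (MonoidHom.id Γ)` in the morphism (`map_id_sum` of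
`CuspidalCohomologyGLShapiroSum`) passes the sum of Hecke operators to cohomology.

## References

* G. Harder, *Eisenstein cohomology of arithmetic groups. The case GL₂*, Invent. Math. 89 (1987), §2
  [Harder1987].
* G. Shimura, *Introduction to the arithmetic theory of automorphic functions* (1971), Ch. 3, §3.1
  [ShimuraIATAF1971].
-/

noncomputable section

open CategoryTheory groupCohomology

universe u

namespace Literature.NumberTheory.Automorphic

namespace TwistedQuotient

/-! ### Additivity of `groupCohomology.map` in the morphism (element form) -/

section Additive

variable {k : Type u} [CommRing k] {G : Type u} [Group G] {A B : Rep k G}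

/-- Element form of `map_id_sum`. [folklore] -/
theorem map_id_sum_apply {J : Type*} (s : Finset J) (φ : J → (A ⟶ B)) (n : ℕ)
    (x : groupCohomology A n) :
    (groupCohomology.map (MonoidHom.id G) (∑ j ∈ s, φ j) n).hom x =
      ∑ j ∈ s, (groupCohomology.map (MonoidHom.id G) (φ j) n).hom x := by
  rw [map_id_sum, ModuleCat.hom_sum, LinearMap.sum_apply]

end Additive

/-! ### The `H`-orbit `H ⧸ (H ∩ L) ↪ 𝒢 ⧸ L` -/

section Orbit

variable {𝒢 : Type u} [Group 𝒢] (L H : Subgroup 𝒢)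

/-- The map `H ⧸ (H ∩ L) → 𝒢 ⧸ L`, `h (H ∩ L) ↦ h L` (the `H`-orbit of the base point).
[folklore] -/
def toQuot : H ⧸ L.subgroupOf H → 𝒢 ⧸ L :=
  Quotient.map' H.subtype fun a b hab => by
    rw [QuotientGroup.leftRel_apply] at hab ⊢
    exact (Subgroup.mem_subgroupOf).1 hab

/-- Unfolding lemma: `toQuot (h) = h L`. [folklore] -/
@[simp]
theorem toQuot_mk (h : H) : toQuot L H (h : H ⧸ L.subgroupOf H) = ((h : 𝒢) : 𝒢 ⧸ L) := rfl

/-- `toQuot` is injective (`h L = h' L` with `h, h' ∈ H` forces `h⁻¹ h' ∈ H ∩ L`). [folklore] -/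
theorem toQuot_injective : Function.Injective (toQuot L H) := by
  intro a b
  induction a using QuotientGroup.induction_on with
  | H a =>
  induction b using QuotientGroup.induction_on with
  | H b =>
  intro hab
  rw [toQuot_mk, toQuot_mk, QuotientGroup.eq] at hab
  exact QuotientGroup.eq.2 ((Subgroup.mem_subgroupOf).2 (by simpa using hab))

/-- `toQuot` is `H`-equivariant. [folklore] -/
theorem toQuot_smul (h : H) (c : H ⧸ L.subgroupOf H) :
    toQuot L H (h • c) = (h : 𝒢) • toQuot L H c := by
  induction c using QuotientGroup.induction_on with
  | H a => rfl

/-- If `H L = 𝒢` then `toQuot` is surjective. [folklore] -/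
theorem toQuot_surjective (hHL : ∀ g : 𝒢, ∃ h : H, ∃ l ∈ L, g = h * l) :
    Function.Surjective (toQuot L H) := by
  intro c
  induction c using QuotientGroup.induction_on with
  | H g =>
  obtain ⟨h, l, hl, rfl⟩ := hHL g
  exact ⟨(h : H ⧸ L.subgroupOf H), by rw [toQuot_mk, QuotientGroup.mk_mul_of_mem _ hl]⟩

/-- If `H L = 𝒢` then `toQuot : H ⧸ (H ∩ L) → 𝒢 ⧸ L` is a bijection. [folklore] -/
theorem toQuot_bijective (hHL : ∀ g : 𝒢, ∃ h : H, ∃ l ∈ L, g = h * l) :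
    Function.Bijective (toQuot L H) :=
  ⟨toQuot_injective L H, toQuot_surjective L H hHL⟩

end Orbit

/-! ### Restriction of functions as a morphism of `Γ`-representations -/

section Restrict

variable {k : Type u} [CommRing k] {Γ 𝒢 : Type u} [Group Γ] [Group 𝒢]
variable (ι : Γ →* 𝒢) (L : Subgroup 𝒢) {V : Type u} [AddCommGroup V] [Module k V]
  (ρ : Representation k Γ V) (H : Subgroup 𝒢) (hH : ∀ γ, ι γ ∈ H)

/-- Restriction of functions along `toQuot`, `k`-linearly. [folklore] -/
def subgroupRestrictLinear : ((𝒢 ⧸ L) → V) →ₗ[k] ((H ⧸ L.subgroupOf H) → V) :=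
  LinearMap.funLeft k V (toQuot L H)

variable {L H} in
/-- Unfolding lemma. [folklore] -/
@[simp]
theorem subgroupRestrictLinear_apply (f : (𝒢 ⧸ L) → V) (c : H ⧸ L.subgroupOf H) :
    subgroupRestrictLinear (k := k) L (V := V) H f c = f (toQuot L H c) := rfl

/-- Restriction intertwines the twisted `Γ`-actions (for `ι` and for `ι` co-restricted to `H`).
[folklore] -/
theorem subgroupRestrictLinear_coeffRepresentation (γ : Γ) (f : (𝒢 ⧸ L) → V) :
    subgroupRestrictLinear (k := k) L H (coeffRepresentation ι L ρ γ f) =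
      coeffRepresentation (ι.codRestrict H hH) (L.subgroupOf H) ρ γ
        (subgroupRestrictLinear (k := k) L H f) := by
  funext c
  rw [subgroupRestrictLinear_apply, coeffRepresentation_apply, coeffRepresentation_apply,
    subgroupRestrictLinear_apply, toQuot_smul]
  rfl

/-- **Restriction of the adelic variable to `H`**: `Fun(𝒢 ⧸ L, V) ⟶ Fun(H ⧸ (H ∩ L), V)` as a
morphism of `Γ`-representations. [folklore] -/
def subgroupRestrict :
    coeffRep ι L ρ ⟶ coeffRep (ι.codRestrict H hH) (L.subgroupOf H) ρ :=
  Rep.ofHom ⟨subgroupRestrictLinear L H, fun γ =>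
    LinearMap.ext fun f => subgroupRestrictLinear_coeffRepresentation ι L ρ H hH γ f⟩

/-- Unfolding lemma. [folklore] -/
@[simp]
theorem subgroupRestrict_hom_apply (f : (𝒢 ⧸ L) → V) (c : H ⧸ L.subgroupOf H) :
    (subgroupRestrict ι L ρ H hH).hom f c = f (toQuot L H c) := rfl

/-- If `H L = 𝒢`, restriction is bijective. [folklore] -/
theorem subgroupRestrict_bijective (hHL : ∀ g : 𝒢, ∃ h : H, ∃ l ∈ L, g = h * l) :
    Function.Bijective (subgroupRestrict ι L ρ H hH).hom := by
  have hb := toQuot_bijective L H hHL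
  constructor
  · intro f f' hff'
    funext c
    obtain ⟨c', rfl⟩ := hb.2 c
    have := congrFun hff' c'
    rwa [subgroupRestrict_hom_apply, subgroupRestrict_hom_apply] at this
  · intro φ
    refine ⟨fun c => φ ((Equiv.ofBijective _ hb).symm c), funext fun c' => ?_⟩
    rw [subgroupRestrict_hom_apply]
    exact congrArg φ ((Equiv.ofBijective _ hb).symm_apply_apply c')

/-- If `H L = 𝒢`, restriction is an isomorphism of `Γ`-representations. [folklore] -/
theorem isIso_subgroupRestrict (hHL : ∀ g : 𝒢, ∃ h : H, ∃ l ∈ L, g = h * l) :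
    IsIso (subgroupRestrict ι L ρ H hH) := by
  have hb := subgroupRestrict_bijective ι L ρ H hH hHL
  have : IsIso ((forget₂ (Rep k Γ) (ModuleCat k)).map (subgroupRestrict ι L ρ H hH)) := by
    change IsIso (ModuleCat.ofHom (subgroupRestrict ι L ρ H hH).hom.toLinearMap)
    exact (ConcreteCategory.isIso_iff_bijective _).2 hb
  exact isIso_of_reflects_iso _ (forget₂ (Rep k Γ) (ModuleCat k))

/-! ### On cohomology -/

/-- **`H^q(Γ, Fun(𝒢 ⧸ L, V)) → H^q(Γ, Fun(H ⧸ (H ∩ L), V))`**, restriction of the adelic variable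
on cohomology. [folklore] -/
abbrev subgroupRestrictMap (q : ℕ) :
    cohomology ι L ρ q ⟶ cohomology (ι.codRestrict H hH) (L.subgroupOf H) ρ q :=
  groupCohomology.map (MonoidHom.id Γ) (subgroupRestrict ι L ρ H hH) q

/-- **If `H L = 𝒢` the cohomology of `S_L` is computed in `H`**:
`H^q(Γ, Fun(𝒢 ⧸ L, V)) ≅ H^q(Γ, Fun(H ⧸ (H ∩ L), V))`. [cite: Harder1987, §2] -/
theorem isIso_subgroupRestrictMap (hHL : ∀ g : 𝒢, ∃ h : H, ∃ l ∈ L, g = h * l) (q : ℕ) :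
    IsIso (subgroupRestrictMap ι L ρ H hH q) := by
  have := isIso_subgroupRestrict ι L ρ H hH hHL
  change IsIso ((groupCohomology.functor k Γ q).map (subgroupRestrict ι L ρ H hH))
  infer_instance

/-- In particular restriction is then injective on cohomology. [folklore] -/
theorem subgroupRestrictMap_injective (hHL : ∀ g : 𝒢, ∃ h : H, ∃ l ∈ L, g = h * l) (q : ℕ) :
    Function.Injective (subgroupRestrictMap ι L ρ H hH q).hom := by
  have := isIso_subgroupRestrictMap ι L ρ H hH hHL q
  exact ((ModuleCat.mono_iff_injective _).1 inferInstance)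

/-! ### Hecke operators -/

/-- **Restriction intertwines `T_g` with a sum of `H`-double-coset operators.**  If
`L g L / L` is the image under `toQuot` of the disjoint union of finitely many finite `H`-double
cosets `(H ∩ L) h_j (H ∩ L) / (H ∩ L)`, then `res (T_g f) = ∑_j T_{h_j} (res f)` on
`Fun(𝒢 ⧸ L, V)`. [cite: ShimuraIATAF1971, Ch. 3, §3.1] -/
theorem subgroupRestrictLinear_heckeFun {g : 𝒢} {J : Type*} [Fintype J] (h : J → H)
    (hfin : ∀ j, (ArithmeticQuotient.doubleCosetQuot (L.subgroupOf H) (h j : H)).Finite)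
    (hD : ArithmeticQuotient.doubleCosetQuot L g =
      ⋃ j, toQuot L H '' ArithmeticQuotient.doubleCosetQuot (L.subgroupOf H) (h j : H))
    (hdisj : Pairwise fun j j' => Disjoint
      (ArithmeticQuotient.doubleCosetQuot (L.subgroupOf H) (h j : H))
      (ArithmeticQuotient.doubleCosetQuot (L.subgroupOf H) (h j' : H)))
    (f : (𝒢 ⧸ L) → V) :
    subgroupRestrictLinear (k := k) L H (ArithmeticQuotient.heckeFun k L g V f) =
      ∑ j, ArithmeticQuotient.heckeFun k (L.subgroupOf H) (h j) V
        (subgroupRestrictLinear (k := k) L H f) := by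
  classical
  have hfinG : (ArithmeticQuotient.doubleCosetQuot L g).Finite := by
    rw [hD]
    exact Set.finite_iUnion fun j => (hfin j).image _
  -- the finset of `L g L / L` as a disjoint union of images
  have hset : hfinG.toFinset =
      Finset.univ.biUnion fun j => (hfin j).toFinset.image (toQuot L H) := by
    ext d
    simp only [Set.Finite.mem_toFinset, Finset.mem_biUnion, Finset.mem_univ, true_and,
      Finset.mem_image]
    rw [hD, Set.mem_iUnion]
    simp only [Set.mem_image]
  have hpd : Set.PairwiseDisjoint (↑(Finset.univ : Finset J))
      fun j => (hfin j).toFinset.image (toQuot L H) := by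
    intro j _ j' _ hjj'
    rw [Function.onFun, Finset.disjoint_iff_ne]
    intro a ha b hb hab
    rw [Finset.mem_image] at ha hb
    obtain ⟨a', ha', rfl⟩ := ha
    obtain ⟨b', hb', rfl⟩ := hb
    have hab' : a' = b' := toQuot_injective L H hab
    subst hab'
    rw [Set.Finite.mem_toFinset] at ha' hb'
    exact Set.disjoint_left.1 (hdisj hjj') ha' hb'
  funext c
  induction c using QuotientGroup.induction_on with
  | H y =>
  rw [subgroupRestrictLinear_apply, toQuot_mk,
    ArithmeticQuotient.heckeFun_apply_coe k L V g f (y : 𝒢) hfinG, hset, Finset.sum_biUnion hpd,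
    Finset.sum_apply]
  refine Finset.sum_congr rfl fun j _ => ?_
  rw [Finset.sum_image fun a _ b _ hab => toQuot_injective L H hab,
    ArithmeticQuotient.heckeFun_apply_coe k (L.subgroupOf H) V (h j) _ y (hfin j)]
  refine Finset.sum_congr rfl fun d _ => ?_
  rw [subgroupRestrictLinear_apply, toQuot_smul]

/-- The same on the `Γ`-representations: `res ≫ (∑_j [(H∩L) h_j (H∩L)]) = [L g L] ≫ res`.
[cite: ShimuraIATAF1971, Ch. 3, §3.1] -/
theorem subgroupRestrict_comp_sum_heckeRepHom {g : 𝒢} {J : Type*} [Fintype J] (h : J → H)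
    (hfin : ∀ j, (ArithmeticQuotient.doubleCosetQuot (L.subgroupOf H) (h j : H)).Finite)
    (hD : ArithmeticQuotient.doubleCosetQuot L g =
      ⋃ j, toQuot L H '' ArithmeticQuotient.doubleCosetQuot (L.subgroupOf H) (h j : H))
    (hdisj : Pairwise fun j j' => Disjoint
      (ArithmeticQuotient.doubleCosetQuot (L.subgroupOf H) (h j : H))
      (ArithmeticQuotient.doubleCosetQuot (L.subgroupOf H) (h j' : H))) :
    heckeRepHom ι L ρ g ≫ subgroupRestrict ι L ρ H hH =
      subgroupRestrict ι L ρ H hH ≫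
        ∑ j, heckeRepHom (ι.codRestrict H hH) (L.subgroupOf H) ρ (h j) := by
  refine Rep.hom_ext (Representation.IntertwiningMap.ext (LinearMap.ext fun f => ?_))
  change subgroupRestrictLinear (k := k) L H (ArithmeticQuotient.heckeFun k L g V f) =
    (∑ j, heckeRepHom (ι.codRestrict H hH) (L.subgroupOf H) ρ (h j)).hom
      (subgroupRestrictLinear (k := k) L H f)
  rw [subgroupRestrictLinear_heckeFun L H h hfin hD hdisj f, Rep.sum_hom,
    Representation.IntertwiningMap.sum_apply]
  rfl

/-- **On cohomology**: `res (T_g x) = ∑_j T_{h_j} (res x)` in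
`H^q(Γ, Fun(H ⧸ (H ∩ L), V))`. [cite: Harder1987, §2] -/
theorem subgroupRestrictMap_heckeEnd_apply {g : 𝒢} {J : Type*} [Fintype J] (h : J → H)
    (hfin : ∀ j, (ArithmeticQuotient.doubleCosetQuot (L.subgroupOf H) (h j : H)).Finite)
    (hD : ArithmeticQuotient.doubleCosetQuot L g =
      ⋃ j, toQuot L H '' ArithmeticQuotient.doubleCosetQuot (L.subgroupOf H) (h j : H))
    (hdisj : Pairwise fun j j' => Disjoint
      (ArithmeticQuotient.doubleCosetQuot (L.subgroupOf H) (h j : H))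
      (ArithmeticQuotient.doubleCosetQuot (L.subgroupOf H) (h j' : H)))
    (q : ℕ) (x : cohomology ι L ρ q) :
    (subgroupRestrictMap ι L ρ H hH q).hom (heckeEnd ι L ρ g q x) =
      ∑ j, heckeEnd (ι.codRestrict H hH) (L.subgroupOf H) ρ (h j) q
        ((subgroupRestrictMap ι L ρ H hH q).hom x) := by
  change (heckeOperator ι L ρ g q ≫ subgroupRestrictMap ι L ρ H hH q).hom x = _
  rw [heckeOperator, subgroupRestrictMap, ← groupCohomology.map_id_comp,
    subgroupRestrict_comp_sum_heckeRepHom ι L ρ H hH h hfin hD hdisj, groupCohomology.map_id_comp,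
    ModuleCat.hom_comp, LinearMap.comp_apply, map_id_sum_apply]

/-- Special case of a single `H`-double coset: if `L g L / L = toQuot((H∩L) h (H∩L)/(H∩L))` then
`res (T_g x) = T_h (res x)`. [folklore] -/
theorem subgroupRestrictMap_heckeEnd_apply_single {g : 𝒢} (h : H)
    (hfin : (ArithmeticQuotient.doubleCosetQuot (L.subgroupOf H) h).Finite)
    (hD : ArithmeticQuotient.doubleCosetQuot L g =
      toQuot L H '' ArithmeticQuotient.doubleCosetQuot (L.subgroupOf H) h)
    (q : ℕ) (x : cohomology ι L ρ q) :
    (subgroupRestrictMap ι L ρ H hH q).hom (heckeEnd ι L ρ g q x) =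
      heckeEnd (ι.codRestrict H hH) (L.subgroupOf H) ρ h q
        ((subgroupRestrictMap ι L ρ H hH q).hom x) := by
  have := subgroupRestrictMap_heckeEnd_apply ι L ρ H hH (J := Unit) (fun _ => h) (fun _ => hfin)
    (by rw [hD, Set.iUnion_const]) (fun j j' hjj' => absurd (Subsingleton.elim j j') hjj') q x
  rwa [Fintype.sum_unique] at this

end Restrict

end TwistedQuotient

end Literature.NumberTheory.Automorphic
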